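import Summits.CriticalPhenomena.CardyFormulaZ2.Theorems.CardyFlipRussoVoronoiHubFromSmirnovGraphDefs
import Summits.CriticalPhenomena.CardyFormulaZ2.Theorems.CardyFlipRussoVoronoiHubFromSmirnovBlackPathChain

/-!
# Stub `crossEvent_subset_graphCross_of_noVoid` of line `moebius-exact-delaunay-dilation-ward`
# (crux `VoronoiHubFromSmirnov`, stmt-CriticalPhenomena-6433; S3b-ii brick, deterministic direction)

**A continuum crossing yields a graph crossing on the no-void event** (Bollobás–Riordan,
*Percolation* (CUP 2006), Ch. 8 §8.1: black clusters of the Voronoi tessellation are the open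
clusters of the Delaunay graph; Benjamini–Schramm, Comm. Math. Phys. 197 (1998), §2, the cluster
event `C`).

Let `c = (c.1, c.2)` be a pair of nonempty locally finite nucleus configurations (black, white) in
CONFIGURATION coordinates, `δ > 0` the mesh, and suppose the no-void condition at configuration
scale `ℓ`: every point `z` of `closure Ω`, read at `z/δ`, has a nucleus of either colour at distance
`< ℓ`.  If `c ∈ crossEvent R δ` — a continuum path `γ` inside `closure Ω ∩ {black}` from the arc
`R.arc 0` to the arc `R.arc 2` — then `c ∈ graphCross K A₀ A₂ δ` as soon as `K ⊇ (ℓδ)-thickening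
of closure Ω`, `A₀ ⊇ (ℓδ)-thickening of R.arc 0`, `A₂ ⊇ (ℓδ)-thickening of R.arc 2`.

Proof.  The rescaled path `t ↦ γ t / δ` runs in the black region of `(c.1, c.2)`, so the landed
`blackPath_cellChain` gives black nuclei `b 0, …, b k ∈ c.1` whose closed Voronoi cells (w.r.t. all
nuclei `c.1 ∪ c.2`) contain `x/δ`, resp. `y/δ`, resp. share a rescaled path point for consecutive
indices.  Every cell of the chain thus contains a point `z/δ` with `z ∈ closure Ω`; the no-void
nucleus `q` near `z/δ` and the cell inequality give `dist (z/δ) (b i) ≤ dist (z/δ) q < ℓ`, i.e.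
`dist z (δ b i) < ℓ δ`: the physical nucleus `δ b i` lies in the `(ℓδ)`-thickening of `closure Ω`
(of `R.arc 0` for `i = 0` with `z = x`, of `R.arc 2` for `i = k` with `z = y`).  Consecutive cells
share a point, which is Delaunay adjacency (`isDelaunayPair_iff_voronoiCell`).  All [folklore].
-/

noncomputable section

namespace Summit.CriticalPhenomena.CardyFormulaZ2.Cruxes.VoronoiHubFromSmirnov.MoebiusExactDelaunayDilationWard

open Set Metric
open Literature.Analysis.FunctionSpaces
open Literature.Probability.RandomPlanarGeometry
open Literature.Probability.LatticeModels (IsDelaunayPair voronoiCell isDelaunayPair_iff_voronoiCell)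
open Literature.Probability.Percolation (blackRegion)

/-! ### Scaling between configuration and physical coordinates -/

/-- **Scaling of distances**: for `δ > 0`, `dist (δ p) z = δ · dist (z/δ) p`. [folklore] -/
theorem csg_dist_ofReal_mul {δ : ℝ} (hδ : 0 < δ) (p z : ℂ) :
    dist ((δ : ℂ) * p) z = δ * dist (z / (δ : ℂ)) p := by
  have hδ' : (δ : ℂ) ≠ 0 := Complex.ofReal_ne_zero.mpr hδ.ne'
  have hz : z = (δ : ℂ) * (z / (δ : ℂ)) := by rw [mul_div_cancel₀ _ hδ']
  conv_lhs => rw [hz, dist_comm]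
  rw [Complex.dist_eq, ← mul_sub, norm_mul, Complex.norm_of_nonneg hδ.le, Complex.dist_eq]

/-- **Thickening membership of a physical nucleus**: if `z ∈ E` and `dist (z/δ) p < ℓ` then
`δ p ∈ thickening (ℓ δ) E`. [folklore] -/
theorem csg_mem_thickening {δ ℓ : ℝ} (hδ : 0 < δ) {E : Set ℂ} {z p : ℂ} (hz : z ∈ E)
    (h : dist (z / (δ : ℂ)) p < ℓ) : (δ : ℂ) * p ∈ Metric.thickening (ℓ * δ) E := by
  rw [Metric.mem_thickening_iff]
  refine ⟨z, hz, ?_⟩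
  rw [csg_dist_ofReal_mul hδ, mul_comm ℓ δ]
  exact mul_lt_mul_of_pos_left h hδ

/-- **No void ⇒ cells are small**: a point of the Voronoi cell of `p` having some site at distance
`< ℓ` is at distance `< ℓ` from `p` (the cell inequality). [folklore] -/
theorem csg_dist_lt_of_mem_voronoiCell {ω : Set ℂ} {w p : ℂ} {ℓ : ℝ} (hw : w ∈ voronoiCell ω p)
    (h : ∃ q ∈ ω, dist w q < ℓ) : dist w p < ℓ := by
  obtain ⟨q, hq, hq'⟩ := h
  exact (hw q hq).trans_lt hq'

/-! ### The statement -/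

/-- **Continuum crossing ⇒ graph crossing on the no-void event** (deterministic inclusion of the
S3b-ii comparison): for nonempty configurations `c.1`, `c.2`, mesh `δ > 0` and configuration scale
`ℓ > 0` such that every point of `closure Ω` (read at `z/δ`) has a nucleus of either colour within
distance `ℓ`, a continuum crossing `c ∈ crossEvent R δ` produces a chain of black nuclei, physically
in the `(ℓδ)`-collar `K` of `closure Ω`, Delaunay-adjacent with respect to all nuclei, starting in the
`(ℓδ)`-collar `A₀` of `R.arc 0` and ending in the `(ℓδ)`-collar `A₂` of `R.arc 2`:
`c ∈ graphCross K A₀ A₂ δ`. -/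
theorem crossEvent_subset_graphCross_of_noVoid : ∀ (R : ConformalRectangle) (δ ℓ : ℝ) (K A₀ A₂ : Set ℂ) (c : Literature.Analysis.FunctionSpaces.PointConfig ℂ × Literature.Analysis.FunctionSpaces.PointConfig ℂ), 0 < δ → 0 < ℓ → (c.1 : Set ℂ).Nonempty → (c.2 : Set ℂ).Nonempty → (∀ z ∈ closure R.carrier, ∃ q ∈ (c.1 : Set ℂ) ∪ (c.2 : Set ℂ), dist (z / (δ : ℂ)) q < ℓ) → Metric.thickening (ℓ * δ) (closure R.carrier) ⊆ K → Metric.thickening (ℓ * δ) (R.arc 0) ⊆ A₀ → Metric.thickening (ℓ * δ) (R.arc 2) ⊆ A₂ → c ∈ crossEvent R δ → c ∈ graphCross K A₀ A₂ δ := by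
  intro R δ ℓ K A₀ A₂ c hδ _hℓ h1 h2 hnv hK hA₀ hA₂ hc
  obtain ⟨x, hx, y, hy, hJ⟩ := hc
  have harc0 : R.arc 0 ⊆ closure R.carrier :=
    (MarkedDomain.arc_subset_frontier R 0).trans frontier_subset_closure
  have harc2 : R.arc 2 ⊆ closure R.carrier :=
    (MarkedDomain.arc_subset_frontier R 2).trans frontier_subset_closure
  -- the crossing path and its rescaling to configuration coordinates
  set γ : Path x y := hJ.somePath
  have hγmem : ∀ t, γ t ∈ closure R.carrier ∩
      {z | infDist (z / (δ : ℂ)) (c.1 : Set ℂ) ≤ infDist (z / (δ : ℂ)) (c.2 : Set ℂ)} :=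
    hJ.somePath_mem
  have hcont : Continuous fun z : ℂ => z / (δ : ℂ) := continuous_id.div_const _
  set γ' : Path (x / (δ : ℂ)) (y / (δ : ℂ)) := γ.map hcont
  have hγ't : ∀ t, γ' t = γ t / (δ : ℂ) := fun t => rfl
  have hblack : ∀ t, γ' t ∈ blackRegion (c.1 : Set ℂ) (c.2 : Set ℂ) := fun t => by
    rw [hγ't, Literature.Probability.Percolation.mem_blackRegion]
    exact (hγmem t).2
  have hfin : ∀ K : Set ℂ, IsCompact K → ((c.1 : Set ℂ) ∩ K).Finite := c.1.finite_inter_isCompact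
  obtain ⟨k, b, hbB, hx0, hyk, hadj⟩ :=
    blackPath_cellChain (c.1 : Set ℂ) (c.2 : Set ℂ) _ _ γ' hfin h1 h2 hblack
  -- a nucleus whose cell contains a rescaled point of `closure Ω` is `ℓ`-close to it
  have hnear : ∀ {z p : ℂ}, z ∈ closure R.carrier →
      z / (δ : ℂ) ∈ voronoiCell ((c.1 : Set ℂ) ∪ (c.2 : Set ℂ)) p → dist (z / (δ : ℂ)) p < ℓ :=
    fun hz hzp => csg_dist_lt_of_mem_voronoiCell hzp (hnv _ hz)
  -- every cell of the chain contains a rescaled point of `closure Ω`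
  have hcellpt : ∀ j : Fin (k + 1), ∃ z ∈ closure R.carrier,
      z / (δ : ℂ) ∈ voronoiCell ((c.1 : Set ℂ) ∪ (c.2 : Set ℂ)) (b j) := by
    intro j
    rcases Fin.eq_zero_or_eq_succ j with rfl | ⟨i, rfl⟩
    · exact ⟨x, harc0 hx, hx0⟩
    · obtain ⟨t, -, ht⟩ := hadj i
      exact ⟨γ t, (hγmem t).1, by rw [← hγ't]; exact ht⟩
  refine ⟨k, b, fun i => hbB i, fun i => ?_, ?_, ?_, fun i => ?_⟩
  · obtain ⟨z, hz, hzb⟩ := hcellpt i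
    exact hK (csg_mem_thickening hδ hz (hnear hz hzb))
  · exact hA₀ (csg_mem_thickening hδ hx (hnear (harc0 hx) hx0))
  · exact hA₂ (csg_mem_thickening hδ hy (hnear (harc2 hy) hyk))
  · obtain ⟨t, ht1, ht2⟩ := hadj i
    exact (isDelaunayPair_iff_voronoiCell (mem_union_left _ (hbB _))
      (mem_union_left _ (hbB _))).2 ⟨γ' t, ht1, ht2⟩

end Summit.CriticalPhenomena.CardyFormulaZ2.Cruxes.VoronoiHubFromSmirnov.MoebiusExactDelaunayDilationWard

end
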